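import Mathlib
import Summits.ResolutionOfSingularities.ResolutionOfSingularities.Theorems.RadicialJungCleanModelsCleanProp44ChartStep
import HarnessLib

/-!
# Route `RadicialJung`, crux `CleanModels` (stmt-ResolutionOfSingularities-15917), line `Sketch` rev 35, stub 6 `stub_cleanProp44` (X44c):
# THE CHART IDENTIFICATION (census (S2)), ONE STOREY — the two specialisations of ✓ `exists_isLocalization_quot_chart` the σ-tower uses:
# `D_{j+1} ≅ D_j` (all chart coordinates vanish) and «the exceptional divisor is a localization of `K[X]`» (one free coordinate)

Seat decomp-res-hand-2 g22 (structural hand); sequel of ✓ `…ChartStep` (the storey: `L ⧸ K₀L`, `K₀ = (ψ cᵢ, u_j : j ∈ J)`, is a localization of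
`(R/I)[T_j : j ≠ i, j ∉ J]` on the abstract chart data `(A, ψ, u, ε, 𝔓, L)` of `Literature/…/BlowupChartRsop.lean`).  With `𝔓` over `𝔪_R`
(`h𝔓`, as produced by ✓ `exists_stalk_ringHom_of_chart`) and `cᵢ ∈ 𝔪_R`:

* §2 `J = all` (the point lies on every strict transform `V(u_j)`; `n = 2`: `z_{j+1} ∈ Z_j`): `exists_unit_congr_of_not_mem` (`A = ψ(R^×) + K₀` off `𝔓`),
  `exists_congr_chart` (`A = ψ(R) + K₀`), `bijective_quotientMap_chart` — **`R/I → L ⧸ K₀L` is BIJECTIVE** (`D_{j+1} ≅ D_j`; surjective: a fraction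
  `a/s` is `ψ(r_a)/ψ(r_s) = ψ(r_a·r_s⁻¹)` modulo `K₀L`; injective: `s·ψ(r) ∈ K₀` with `s ≡ ψ(unit)` forces — through `ε` and ✓ `quotientSpanXEquiv` —
  `unit·r ∈ I`), `isLocalization_quot_chart_all` — hence «is a localization of `K` at `M₀`» passes from `R/I` to `L ⧸ K₀L` for ANY base `K`
  (the invariant «`𝒪_{Z_j,z_{j+1}}` is the localization of `κ(c)[u]`» climbs the σ-tower unchanged).
* §3 `J` misses ONE index `i₀` (the exceptional divisor of a curve blow-up: `n = 2`, `J = ∅`; the line `Z_0 ⊂ E_c` of the point blow-up: `n = 3`,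
  `J = {t}`): `exists_isLocalization_quot_chart_polynomial` — if `R/I` is a localization of a base `K`, then `L ⧸ K₀L` is a localization of `K[X]` at
  some submonoid for every `K[X]`-structure with `C g ↦ (image of g)`, `X ↦ u_{i₀}` (Mathlib `Polynomial.isLocalization` + `MvPolynomial.uniqueAlgEquiv`
  + two storeys); with `K = κ(c)[u]` this is the input of ✓ `isLocalizationAtPrime_span_pair_of_mem` / ✓ `exists_prime_isLocalizationAtPrime_span`
  (p838494), hence of ✓ `birth_descent_of_isLocalization` / ✓ `exists_successor_of_isLocalization` (p838418); with `K = κ(c)`, `R/I = κ(c)`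
  (point blow-up) it STARTS the invariant: `𝒪_{Z_0,z_1}` is a localization of `κ(c)[u]`.

What remains of (S2): instantiate on the tree's blowings up (✓ `IsBlowup.exists_chartFamily`, ✓ `exists_stalk_ringHom_of_chart`, ✓ `chartQuotEquiv`,
as ✓ `isRsopPart_chartFamily_reesChart` does) level by level, and compare the cocone's `eval₂` structure of ✓ `tower_face` with the transported one
(✓ `isLocalization_of_algebraMap_eq`).  Honest framing: OURS, commutative algebra only; nothing here proves X44c, any case of `CleanModels`, or resolution
of singularities in characteristic `p`. [cite: StacksProject, Tag 0804, Tag 0BIQ] [cite: Matsumura1987, Thm. 4.1–4.3] [cite: CossartPiltant2008, Prop. 4.4 (proof, p. 11)]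
-/

noncomputable section

set_option linter.dupNamespace false -- mandated namespace of this single-conjunct summit

open IsLocalRing Literature.AlgebraicGeometry.Resolution

namespace Summit.ResolutionOfSingularities.ResolutionOfSingularities.Theorems.RadicialJung.CleanModels

universe u

/-! ## §2 All chart coordinates vanish: `R/I ≅ L ⧸ (ψ cᵢ, u)L` -/

section AllVanish

variable {R : Type u} [CommRing R] [IsLocalRing R] {n : ℕ} (c : Fin n → R) (i : Fin n)
  {A : Type u} [CommRing A] (L : Type u) [CommRing L] (ψ : R →+* A) (u : Fin n → A)
  (ε : MvPolynomial {j : Fin n // j ≠ i} (R ⧸ Ideal.span (Set.range c)) ≃+* A ⧸ Ideal.span {ψ (c i)})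
  (hεC : ∀ r : R, ε (MvPolynomial.C (Ideal.Quotient.mk (Ideal.span (Set.range c)) r)) = Ideal.Quotient.mk _ (ψ r))
  (hεX : ∀ j : {j : Fin n // j ≠ i}, ε (MvPolynomial.X j) = Ideal.Quotient.mk _ (u j.1))
  (𝔓 : Ideal A) [𝔓.IsPrime] (h𝔓 : 𝔓.comap ψ = maximalIdeal R) [Algebra A L] [IsLocalization.AtPrime L 𝔓]
  (K₀ : Ideal A) (hK₀ : K₀ = Ideal.span {ψ (c i)} ⊔ Ideal.span ((fun j : {j : Fin n // j ≠ i} => u j.1) '' Set.univ))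
  (hall : ∀ j : {j : Fin n // j ≠ i}, u j.1 ∈ 𝔓) (hci : c i ∈ maximalIdeal R)

include hεC hεX h𝔓 hK₀ hall hci in
omit [𝔓.IsPrime] [Algebra A L] [IsLocalization.AtPrime L 𝔓] in
/-- **`A = ψ(R^×) + K₀` off `𝔓`**: an element of `A` outside `𝔓` is congruent modulo `K₀ = (ψ cᵢ, u_j : j ≠ i)` to `ψ(r)` with `r` a UNIT of `R`
(through `ε`, `A ⧸ K₀ ≅ R/I` consists of constants; `r ∈ 𝔪_R` would put the element in `𝔓`). [folklore] -/
theorem exists_unit_congr_of_not_mem {a : A} (ha : a ∉ 𝔓) : ∃ r : R, IsUnit r ∧ a - ψ r ∈ K₀ := by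
  classical
  -- modulo `(ψ cᵢ)`, `a` is `ε q` for a polynomial `q`; modulo the variables, `q` is a constant
  have hvar : ∀ q : MvPolynomial {j : Fin n // j ≠ i} (R ⧸ Ideal.span (Set.range c)), ∃ r : R,
      (ε q : A ⧸ Ideal.span {ψ (c i)}) - Ideal.Quotient.mk _ (ψ r) ∈
        (Ideal.span ((fun j : {j : Fin n // j ≠ i} => u j.1) '' Set.univ)).map (Ideal.Quotient.mk (Ideal.span {ψ (c i)})) := by
    intro q
    induction q using MvPolynomial.induction_on with
    | C r =>
      obtain ⟨r, rfl⟩ := Ideal.Quotient.mk_surjective r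
      exact ⟨r, by rw [hεC, sub_self]; exact Ideal.zero_mem _⟩
    | add p q hp hq =>
      obtain ⟨r₁, h₁⟩ := hp
      obtain ⟨r₂, h₂⟩ := hq
      refine ⟨r₁ + r₂, ?_⟩
      have : (ε (p + q) : A ⧸ Ideal.span {ψ (c i)}) - Ideal.Quotient.mk _ (ψ (r₁ + r₂)) =
          ((ε p : A ⧸ Ideal.span {ψ (c i)}) - Ideal.Quotient.mk _ (ψ r₁)) + ((ε q : A ⧸ Ideal.span {ψ (c i)}) - Ideal.Quotient.mk _ (ψ r₂)) := by
        rw [map_add, map_add, map_add]; ring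
      rw [this]
      exact Ideal.add_mem _ h₁ h₂
    | mul_X p j _ =>
      refine ⟨0, ?_⟩
      rw [map_zero, map_zero, sub_zero, map_mul, hεX]
      exact Ideal.mul_mem_left _ _ (Ideal.mem_map_of_mem _ (Ideal.subset_span ⟨j, Set.mem_univ _, rfl⟩))
  obtain ⟨q, hq⟩ := ε.surjective (Ideal.Quotient.mk (Ideal.span {ψ (c i)}) a)
  obtain ⟨r, hr⟩ := hvar q
  rw [hq, ← map_sub, Ideal.mem_quotient_iff_mem_sup, sup_comm, ← hK₀] at hr
  refine ⟨r, ?_, hr⟩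
  -- `r` is a unit: otherwise `ψ r ∈ 𝔓`, and `a = (a - ψ r) + ψ r ∈ 𝔓`
  by_contra hru
  have hψr : ψ r ∈ 𝔓 := by rw [← Ideal.mem_comap, h𝔓]; exact (IsLocalRing.mem_maximalIdeal r).mpr hru
  have hK₀𝔓 : K₀ ≤ 𝔓 := chartIdeal_le_prime c i ψ u 𝔓 Set.univ K₀ hK₀ h𝔓 hci (fun j _ => hall j)
  exact ha (by simpa using Ideal.add_mem _ (hK₀𝔓 hr) hψr)

include hεC hεX h𝔓 hK₀ hall hci in
omit [Algebra A L] [IsLocalization.AtPrime L 𝔓] in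
/-- Every element of `A` is congruent modulo `K₀` to some `ψ(r)`. [folklore] -/
theorem exists_congr_chart (b : A) : ∃ r : R, b - ψ r ∈ K₀ := by
  -- some element `s ∉ 𝔓` exists (`1`); off `𝔓` use the previous lemma, on `𝔓` shift by `1`
  by_cases hb : b ∈ 𝔓
  · have hb1 : b + 1 ∉ 𝔓 := fun h => (inferInstance : 𝔓.IsPrime).ne_top ((Ideal.eq_top_iff_one _).mpr (by simpa using Ideal.sub_mem _ h hb))
    obtain ⟨r₁, -, hr₁⟩ := exists_unit_congr_of_not_mem c i ψ u ε hεC hεX 𝔓 h𝔓 K₀ hK₀ hall hci hb1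
    obtain ⟨r₀, -, hr₀⟩ := exists_unit_congr_of_not_mem c i ψ u ε hεC hεX 𝔓 h𝔓 K₀ hK₀ hall hci
      (show (1 : A) ∉ 𝔓 from fun h => (inferInstance : 𝔓.IsPrime).ne_top ((Ideal.eq_top_iff_one _).mpr h))
    refine ⟨r₁ - r₀, ?_⟩
    have : b - ψ (r₁ - r₀) = (b + 1 - ψ r₁) - (1 - ψ r₀) := by rw [map_sub]; ring
    rw [this]
    exact Ideal.sub_mem _ hr₁ hr₀
  · obtain ⟨r₁, -, hr₁⟩ := exists_unit_congr_of_not_mem c i ψ u ε hεC hεX 𝔓 h𝔓 K₀ hK₀ hall hci hb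
    exact ⟨r₁, hr₁⟩

include hεC hεX h𝔓 hK₀ hall hci in
/-- **`R/I → L ⧸ K₀L` is bijective**, `K₀ = (ψ cᵢ, u_j : j ≠ i)` (`D_{j+1} ≅ D_j` along the σ-tower: the point lies on every strict transform `V(u_j)`).
Surjective: a fraction `a/s` with `s ∉ 𝔓` is `ψ(r)/ψ(r_s) = ψ(r·r_s⁻¹)` modulo `K₀L`; injective: `s·ψ(r) ∈ K₀` with `s ≡ ψ(unit)` forces `ψ(unit·r) ∈ K₀`,
i.e. (through `ε` and ✓ `quotientSpanXEquiv`) `unit·r ∈ I`. [cite: StacksProject, Tag 0BIQ] [cite: Matsumura1987, Thm. 4.1–4.3] -/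
theorem bijective_quotientMap_chart (hu : ∀ j, ψ (c j) = ψ (c i) * u j) :
    Function.Bijective (Ideal.quotientMap (K₀.map (algebraMap A L)) ((algebraMap A L).comp ψ)
      (span_range_le_comap_chartIdeal c i L ψ u Set.univ K₀ hK₀ hu)) := by
  classical
  have hθmk : ∀ r : R, Ideal.quotientMap (K₀.map (algebraMap A L)) ((algebraMap A L).comp ψ)
      (span_range_le_comap_chartIdeal c i L ψ u Set.univ K₀ hK₀ hu) (Ideal.Quotient.mk _ r) = Ideal.Quotient.mk _ (algebraMap A L (ψ r)) :=
    fun r => rfl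
  -- every `c_j` lies in `𝔪_R`, so `R/I` is non-trivial
  have hIle : Ideal.span (Set.range c) ≤ maximalIdeal R := by
    rw [Ideal.span_le]
    rintro _ ⟨j, rfl⟩
    rw [SetLike.mem_coe, ← h𝔓, Ideal.mem_comap, hu j]
    exact Ideal.mul_mem_right _ _ (by rw [← Ideal.mem_comap, h𝔓]; exact hci)
  haveI : Nontrivial (R ⧸ Ideal.span (Set.range c)) :=
    Ideal.Quotient.nontrivial_iff.mpr (fun h => (maximalIdeal.isMaximal R).ne_top (top_le_iff.mp (h ▸ hIle)))
  constructor
  · rw [injective_iff_map_eq_zero]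
    intro x hx
    obtain ⟨r, rfl⟩ := Ideal.Quotient.mk_surjective x
    rw [hθmk, Ideal.Quotient.eq_zero_iff_mem, IsLocalization.mem_map_algebraMap_iff 𝔓.primeCompl] at hx
    obtain ⟨⟨⟨k₀, hk₀⟩, ⟨s, hs⟩⟩, hks⟩ := hx
    dsimp only at hks
    -- `s * ψ r - k₀` dies in `L`, hence is killed by some `s' ∉ 𝔓`
    obtain ⟨⟨s', hs'⟩, hs'eq⟩ := (IsLocalization.eq_iff_exists 𝔓.primeCompl L).mp
      (show algebraMap A L (s * ψ r) = algebraMap A L k₀ by rw [map_mul, mul_comm]; exact hks)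
    dsimp only at hs'eq
    have hmem : (s' * s) * ψ r ∈ K₀ := by
      rw [mul_assoc, hs'eq]
      exact Ideal.mul_mem_left _ _ hk₀
    have hss : s' * s ∉ 𝔓 := fun h => ((inferInstance : 𝔓.IsPrime).mem_or_mem h).elim hs' hs
    obtain ⟨r₁, hr₁u, hr₁⟩ := exists_unit_congr_of_not_mem c i ψ u ε hεC hεX 𝔓 h𝔓 K₀ hK₀ hall hci hss
    -- `ψ (r₁ r) ∈ K₀`
    have hψ : ψ (r₁ * r) ∈ K₀ := by
      have : ψ (r₁ * r) = (s' * s) * ψ r - (s' * s - ψ r₁) * ψ r := by rw [map_mul]; ring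
      rw [this]
      exact Ideal.sub_mem _ hmem (Ideal.mul_mem_right _ _ hr₁)
    -- through `ε`: `C (r₁ r) ∈ (T_j : all j)`, so `r₁ r ∈ I`
    have h1 : Ideal.Quotient.mk (Ideal.span {ψ (c i)}) (ψ (r₁ * r)) ∈
        (Ideal.span ((fun j : {j : Fin n // j ≠ i} => u j.1) '' Set.univ)).map (Ideal.Quotient.mk (Ideal.span {ψ (c i)})) := by
      rw [Ideal.mem_quotient_iff_mem_sup, sup_comm, ← hK₀]; exact hψ
    rw [← hεC, map_chartIdeal_eq_map_span_X c i ψ u ε hεX Set.univ,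
      Ideal.mem_map_iff_of_surjective (ε : MvPolynomial {j : Fin n // j ≠ i} (R ⧸ Ideal.span (Set.range c)) →+* A ⧸ Ideal.span {ψ (c i)})
        ε.surjective] at h1
    obtain ⟨q, hq, hqe⟩ := h1
    rw [RingHom.coe_coe] at hqe
    have hqC : q = MvPolynomial.C (Ideal.Quotient.mk (Ideal.span (Set.range c)) (r₁ * r)) := ε.injective hqe
    rw [hqC] at hq
    have hzero : Ideal.Quotient.mk (Ideal.span (Set.range c)) (r₁ * r) = 0 := by
      have h3 := congrArg (MvPolynomial.quotientSpanXEquiv (R := R ⧸ Ideal.span (Set.range c)) (Set.univ : Set {j : Fin n // j ≠ i}))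
        (Ideal.Quotient.eq_zero_iff_mem.mpr hq)
      rw [MvPolynomial.quotientSpanXEquiv_mk_C, map_zero, MvPolynomial.C_eq_zero] at h3
      exact h3
    rw [map_mul] at hzero
    exact (IsUnit.mul_right_eq_zero (hr₁u.map (Ideal.Quotient.mk (Ideal.span (Set.range c))))).mp hzero
  · -- surjective: `a/s ≡ ψ(r_a)/ψ(r_s) = ψ(r_a · r_s⁻¹)`
    intro q
    obtain ⟨q, rfl⟩ := Ideal.Quotient.mk_surjective q
    obtain ⟨⟨a, ⟨s, hs⟩⟩, has⟩ := IsLocalization.surj 𝔓.primeCompl q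
    dsimp only at has
    obtain ⟨rs, hrsu, hrs⟩ := exists_unit_congr_of_not_mem c i ψ u ε hεC hεX 𝔓 h𝔓 K₀ hK₀ hall hci hs
    obtain ⟨ra, hra⟩ := exists_congr_chart c i ψ u ε hεC hεX 𝔓 h𝔓 K₀ hK₀ hall hci a
    obtain ⟨v, hv⟩ := hrsu
    refine ⟨Ideal.Quotient.mk _ (ra * ↑v⁻¹), ?_⟩
    rw [hθmk, Ideal.Quotient.eq]
    -- `ψ(r_a v⁻¹) - q ∈ K₀L`: multiply by the unit `ψ v`
    have hunit : IsUnit (algebraMap A L (ψ (v : R))) := (v.isUnit.map ψ).map (algebraMap A L)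
    rw [← Ideal.unit_mul_mem_iff_mem _ hunit]
    have h1 : algebraMap A L (ψ (v : R)) * algebraMap A L (ψ (ra * ↑v⁻¹)) = algebraMap A L (ψ ra) := by
      rw [← map_mul, ← map_mul, mul_left_comm, Units.mul_inv, mul_one]
    have h2 : algebraMap A L (ψ (v : R)) * q = algebraMap A L a - algebraMap A L (s - ψ rs) * q := by
      rw [hv, map_sub (algebraMap A L), sub_mul, mul_comm (algebraMap A L s) q, has]
      ring
    have key : algebraMap A L (ψ (v : R)) * (algebraMap A L (ψ (ra * ↑v⁻¹)) - q) =
        -(algebraMap A L (a - ψ ra)) + algebraMap A L (s - ψ rs) * q := by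
      rw [mul_sub, h1, h2, map_sub (algebraMap A L) a]
      ring
    rw [key]
    exact Ideal.add_mem _ (Submodule.neg_mem _ (Ideal.mem_map_of_mem _ hra)) (Ideal.mul_mem_right _ _ (Ideal.mem_map_of_mem _ hrs))

include hεC hεX h𝔓 hK₀ hall hci in
/-- **The invariant of the σ-tower passes through a storey**: if `R/I` is a localization of a base ring `K` at `M₀`, then so is `L ⧸ K₀L`,
`K₀ = (ψ cᵢ, u_j : j ≠ i)` — for every `K`-algebra structure factoring through `R/I → L ⧸ K₀L` («`𝒪_{Z_j,z_{j+1}}` is again the localization of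
`κ(c)[u]`»). [cite: Matsumura1987, Thm. 4.1–4.3] -/
theorem isLocalization_quot_chart_all (hu : ∀ j, ψ (c j) = ψ (c i) * u j) {K : Type*} [CommRing K]
    [Algebra K (R ⧸ Ideal.span (Set.range c))] (M₀ : Submonoid K) [IsLocalization M₀ (R ⧸ Ideal.span (Set.range c))]
    [Algebra K (L ⧸ K₀.map (algebraMap A L))]
    (hK : ∀ g : K, algebraMap K (L ⧸ K₀.map (algebraMap A L)) g =
      Ideal.quotientMap (K₀.map (algebraMap A L)) ((algebraMap A L).comp ψ) (span_range_le_comap_chartIdeal c i L ψ u Set.univ K₀ hK₀ hu)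
        (algebraMap K (R ⧸ Ideal.span (Set.range c)) g)) :
    IsLocalization M₀ (L ⧸ K₀.map (algebraMap A L)) := by
  have hbij := bijective_quotientMap_chart c i L ψ u ε hεC hεX 𝔓 h𝔓 K₀ hK₀ hall hci hu
  let e : (R ⧸ Ideal.span (Set.range c)) ≃ₐ[K] (L ⧸ K₀.map (algebraMap A L)) :=
    { RingEquiv.ofBijective _ hbij with
      commutes' := fun g => by
        change Ideal.quotientMap (K₀.map (algebraMap A L)) ((algebraMap A L).comp ψ)
          (span_range_le_comap_chartIdeal c i L ψ u Set.univ K₀ hK₀ hu) (algebraMap K _ g) = algebraMap K _ g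
        rw [hK] }
  exact IsLocalization.isLocalization_of_algEquiv M₀ e

end AllVanish

/-! ## §3 One free chart coordinate: a localization of `K[X]` -/

section OneFree

variable {R : Type u} [CommRing R] {n : ℕ} (c : Fin n → R) (i : Fin n)
  {A : Type u} [CommRing A] (L : Type u) [CommRing L] (ψ : R →+* A) (u : Fin n → A)
  (ε : MvPolynomial {j : Fin n // j ≠ i} (R ⧸ Ideal.span (Set.range c)) ≃+* A ⧸ Ideal.span {ψ (c i)})
  (hεC : ∀ r : R, ε (MvPolynomial.C (Ideal.Quotient.mk (Ideal.span (Set.range c)) r)) = Ideal.Quotient.mk _ (ψ r))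
  (hεX : ∀ j : {j : Fin n // j ≠ i}, ε (MvPolynomial.X j) = Ideal.Quotient.mk _ (u j.1))
  (𝔓 : Ideal A) [𝔓.IsPrime] [Algebra A L] [IsLocalization.AtPrime L 𝔓]
  (sJ : Set {j : Fin n // j ≠ i}) (K₀ : Ideal A) (hK₀ : K₀ = Ideal.span {ψ (c i)} ⊔ Ideal.span ((fun j : {j : Fin n // j ≠ i} => u j.1) '' sJ))

include hεC hεX 𝔓 hK₀ in
/-- **One free variable** (`J` misses exactly one index `i₀`): if `R/I` is a localization of a base ring `K` at `M₀`, then `L ⧸ K₀L` is a localization of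
`K[X]` at some submonoid — for every `K[X]`-algebra structure with `C g ↦ (image of g through R/I)` and `X ↦ u_{i₀}` (`𝒪_{E_Z,z′}` is a localization of
`κ(c)[u][T]`; `𝒪_{Z_0,z_1}` is a localization of `κ(c)[u]`).  Mathlib: `Polynomial.isLocalization` + two storeys. [cite: StacksProject, Tag 0BIQ]
[cite: Matsumura1987, Thm. 4.1–4.3] -/
theorem exists_isLocalization_quot_chart_polynomial (hu : ∀ j, ψ (c j) = ψ (c i) * u j)
    (i₀ : {j : Fin n // j ≠ i}) (hi₀ : i₀ ∉ sJ) (huniq : ∀ j : {j : Fin n // j ≠ i}, j ∉ sJ → j = i₀)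
    {K : Type*} [CommRing K] [Algebra K (R ⧸ Ideal.span (Set.range c))] (M₀ : Submonoid K) [IsLocalization M₀ (R ⧸ Ideal.span (Set.range c))]
    [algQ : Algebra (Polynomial K) (L ⧸ K₀.map (algebraMap A L))]
    (hKC : ∀ g : K, algebraMap (Polynomial K) (L ⧸ K₀.map (algebraMap A L)) (Polynomial.C g) =
      Ideal.quotientMap (K₀.map (algebraMap A L)) ((algebraMap A L).comp ψ) (span_range_le_comap_chartIdeal c i L ψ u sJ K₀ hK₀ hu)
        (algebraMap K (R ⧸ Ideal.span (Set.range c)) g))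
    (hKX : algebraMap (Polynomial K) (L ⧸ K₀.map (algebraMap A L)) Polynomial.X = Ideal.Quotient.mk _ (algebraMap A L (u i₀.1))) :
    ∃ N : Submonoid (Polynomial K), IsLocalization N (L ⧸ K₀.map (algebraMap A L)) := by
  classical
  -- abbreviations (terms only): the polynomial rings and the canonical map `θ : R/I → L ⧸ K₀L`
  let θ : (R ⧸ Ideal.span (Set.range c)) →+* L ⧸ K₀.map (algebraMap A L) :=
    Ideal.quotientMap (K₀.map (algebraMap A L)) ((algebraMap A L).comp ψ) (span_range_le_comap_chartIdeal c i L ψ u sJ K₀ hK₀ hu)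
  have hθmk : ∀ r : R, θ (Ideal.Quotient.mk _ r) = Ideal.Quotient.mk _ (algebraMap A L (ψ r)) := fun r => rfl
  -- the one-variable polynomial ring: `PJ ≅ D[X]`
  letI : Unique {j : {j : Fin n // j ≠ i} // j ∉ sJ} :=
    { default := ⟨i₀, hi₀⟩, uniq := fun j => Subtype.ext (huniq j.1 j.2) }
  let eP : MvPolynomial {j : {j : Fin n // j ≠ i} // j ∉ sJ} (R ⧸ Ideal.span (Set.range c)) ≃ₐ[R ⧸ Ideal.span (Set.range c)]
      Polynomial (R ⧸ Ideal.span (Set.range c)) := MvPolynomial.uniqueAlgEquiv _ _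
  -- the `D[X]`-algebra structure on `Q`: `C d ↦ θ d`, `X ↦ u_{i₀}`
  let φD : Polynomial (R ⧸ Ideal.span (Set.range c)) →+* L ⧸ K₀.map (algebraMap A L) :=
    Polynomial.eval₂RingHom θ (Ideal.Quotient.mk _ (algebraMap A L (u i₀.1)))
  letI algD : Algebra (Polynomial (R ⧸ Ideal.span (Set.range c))) (L ⧸ K₀.map (algebraMap A L)) := φD.toAlgebra
  -- (1) `Q` is a localization of `D[X]` at some submonoid: the storey through `eP`
  letI algPJ : Algebra (MvPolynomial {j : {j : Fin n // j ≠ i} // j ∉ sJ} (R ⧸ Ideal.span (Set.range c))) (L ⧸ K₀.map (algebraMap A L)) :=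
    (φD.comp eP.toRingEquiv.toRingHom).toAlgebra
  have hC' : ∀ r : R, algebraMap (MvPolynomial {j : {j : Fin n // j ≠ i} // j ∉ sJ} (R ⧸ Ideal.span (Set.range c)))
      (L ⧸ K₀.map (algebraMap A L)) (MvPolynomial.C (Ideal.Quotient.mk _ r)) = Ideal.Quotient.mk _ (algebraMap A L (ψ r)) := by
    intro r
    change φD (eP (MvPolynomial.C (Ideal.Quotient.mk _ r))) = _
    rw [MvPolynomial.uniqueAlgEquiv_apply, MvPolynomial.eval₂_C]
    change Polynomial.eval₂ θ _ (Polynomial.C _) = _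
    rw [Polynomial.eval₂_C, hθmk]
  have hX' : ∀ j : {j : {j : Fin n // j ≠ i} // j ∉ sJ}, algebraMap (MvPolynomial {j : {j : Fin n // j ≠ i} // j ∉ sJ} (R ⧸ Ideal.span (Set.range c)))
      (L ⧸ K₀.map (algebraMap A L)) (MvPolynomial.X j) = Ideal.Quotient.mk _ (algebraMap A L (u j.1.1)) := by
    intro j
    obtain ⟨j, hj⟩ := j
    obtain rfl : j = i₀ := huniq j hj
    change φD (eP (MvPolynomial.X _)) = _
    rw [MvPolynomial.uniqueAlgEquiv_apply, MvPolynomial.eval₂_X]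
    change Polynomial.eval₂ θ _ Polynomial.X = _
    rw [Polynomial.eval₂_X]
  obtain ⟨M, hM⟩ := exists_isLocalization_quot_chart c i L ψ u ε hεC hεX 𝔓 sJ K₀ hK₀ hC' hX'
  have hMD : @IsLocalization _ _ (M.map eP.toRingEquiv.toMonoidHom) (L ⧸ K₀.map (algebraMap A L)) _ algD := by
    have h := @IsLocalization.isLocalization_of_base_ringEquiv _ _ M (L ⧸ K₀.map (algebraMap A L)) _ algPJ _ _ hM eP.toRingEquiv
    refine isLocalization_of_algebraMap_eq _ _ _ (fun x => ?_) h
    change (φD.comp eP.toRingEquiv.toRingHom) (eP.toRingEquiv.symm x) = φD x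
    rw [RingHom.comp_apply]
    exact congrArg φD (eP.toRingEquiv.apply_symm_apply x)
  -- (2) `D[X]` is a localization of `K[X]` at `M₀.map C`; two storeys
  letI algKX : Algebra (Polynomial K) (Polynomial (R ⧸ Ideal.span (Set.range c))) :=
    (Polynomial.mapRingHom (algebraMap K (R ⧸ Ideal.span (Set.range c)))).toAlgebra
  have hKD : @IsLocalization _ _ (M₀.map (Polynomial.C : K →+* Polynomial K)) (Polynomial (R ⧸ Ideal.span (Set.range c))) _ algKX := by
    have := Polynomial.isLocalization M₀ (R ⧸ Ideal.span (Set.range c))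
    refine isLocalization_of_algebraMap_eq _ _ _ (fun x => ?_) this
    rfl
  letI algKQ : Algebra (Polynomial K) (L ⧸ K₀.map (algebraMap A L)) :=
    (φD.comp (Polynomial.mapRingHom (algebraMap K (R ⧸ Ideal.span (Set.range c))))).toAlgebra
  haveI hst : IsScalarTower (Polynomial K) (Polynomial (R ⧸ Ideal.span (Set.range c))) (L ⧸ K₀.map (algebraMap A L)) :=
    IsScalarTower.of_algebraMap_eq (fun x => rfl)
  haveI := hKD
  haveI := hMD
  have htower : IsLocalization (IsLocalization.localizationLocalizationSubmodule (M₀.map (Polynomial.C : K →+* Polynomial K))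
      (M.map eP.toRingEquiv.toMonoidHom)) (L ⧸ K₀.map (algebraMap A L)) :=
    IsLocalization.localization_localization_isLocalization _ _ _
  refine ⟨_, isLocalization_of_algebraMap_eq _ algKQ algQ (fun x => ?_) htower⟩
  -- (3) the composite agrees with the given structure on `C g` and `X`
  change (φD.comp (Polynomial.mapRingHom (algebraMap K (R ⧸ Ideal.span (Set.range c))))) x =
    @algebraMap (Polynomial K) (L ⧸ K₀.map (algebraMap A L)) _ _ algQ x
  revert x
  rw [← RingHom.ext_iff]
  refine Polynomial.ringHom_ext (fun g => ?_) ?_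
  · rw [RingHom.comp_apply, Polynomial.coe_mapRingHom, Polynomial.map_C, hKC]
    change Polynomial.eval₂ θ _ (Polynomial.C _) = _
    rw [Polynomial.eval₂_C]
  · rw [RingHom.comp_apply, Polynomial.coe_mapRingHom, Polynomial.map_X, hKX]
    change Polynomial.eval₂ θ _ Polynomial.X = _
    rw [Polynomial.eval₂_X]

end OneFree

end Summit.ResolutionOfSingularities.ResolutionOfSingularities.Theorems.RadicialJung.CleanModels

end
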